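import Summits.HubbardSuperconductivity.HubbardLadder.Bounds.StiffnessFromEnergyBracketsSharp
import Summits.HubbardSuperconductivity.HubbardLadder.Bounds.AttractiveStiffnessCeiling
import HarnessLib

/-!
# Hubbard ladder — Bounds: the tight chord hook, part 2 — kernel-only instances
# (bounds.tex Thm 3♯ instances, Thm 7(v♯)(vi♯) Mott window, Thm 8♯ attractive class; typed AND proved)

HONEST FRAMING (cell pub-hubbard): ladder R1–R4 with certified numbers; no claim on H/H₀. Bounds for
MODEL CLASSES (`hubbardTorus 2 L 1 U` on the even `L × L` torus and its thermodynamic limit); no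
materials claim. Part 1 = `StiffnessFromEnergyBracketsSharp.lean` (the tight chord
`⟨-T⟩_ψ ≤ (U₁ R - U L₁)/(U - U₁)` and the stiffness nodes). This file feeds the tight nodes with
brackets that are THEOREMS OF THE TREE only (no certified-numerics input): the Langer–Mattis decimal
rows `energyDensity2D_one_{four,six}_one_ge`, the closed forms `lmClosed` / `sdwClosed`
(`MottStiffnessCeiling`), and the attractive closed-form brackets of `AttractiveStiffnessCeiling`.

## What is proved (no `sorry`, no new axioms) — every constant below improves a LANDED one

* `StiffnessCeilingHalfFillingU8Sharp`: `ρ_s ≤ (r + 2.1794)/4` for any certified `e(8,1) ≤ r`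
  (landed `StiffnessCeilingHalfFillingU8`: `(2(r + 1.0897) + 0.74512)/4`; at the cell's
  `r = -0.4963187` this is `0.4208` vs `0.4830`, still above the one-body `0.4053` — honest).
* `StiffnessCeilingHalfFillingU12Sharp`: `ρ_s ≤ (r + 1.7731)/4` for any certified `e(12,1) ≤ r`
  (`U₁ = 6`), and `StiffnessCeilingHalfFillingU12Row`: GIVEN `e(12,1) ≤ -0.3459422` (the tree's typed
  plaquette-LUC row `Bounds/DerivedTLRowsTPrime` is slightly stronger) `ρ_s ≤ 0.3568 < 4/π² = 0.40528`
  — the first ceiling below the `U`-independent one-body value whose many-body LOWER input is a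
  kernel theorem (only the upper row is certified numerics).
* `MottStiffnessCeilingSharp[TL]` (Thm 7(v♯)(vi♯)): half filling, `0 ≤ U₁ < U`, `Δ ≠ 0`:
  `ρ_s ≤ ((U₁ sdwClosed U Δ - U lmClosed U₁)/(U - U₁))/4`; at `U₁ = Δ = U/2` this is
  `(√(256 + U²) - U)/16 + U/(16 + U²) - 2/√(64 + U²) = 7 t²/U + O(U⁻³)` (landed: `≈ 8 t²/U`; the
  asymptotically optimal `U₁/U = 2 - √2` gives `(4 + 2√2) t²/U = 6.83 t²/U`). Kernel decimals:
  `MottStiffnessCeilingU14Sharp` `ρ_s ≤ 0.4` (`< 4/π²`; the landed window opened at `U ≈ 17 t`,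
  now at `U ≈ 13.5 t`) and `MottStiffnessCeilingU20Sharp` `ρ_s ≤ 0.307` (landed `0.36`).
* `AttractiveKineticCeilingSharp` `⟨-T⟩_ψ ≤ 32 L²/|U|` (landed `40`), `AttractiveStiffnessCeilingSharp[TL]`
  `ρ_s ≤ 8 t²/|U|` (landed `10`), `AttractiveStiffnessBECLimitSharp` (`U ≤ -8/ε ⟹ ρ_s ≤ ε`),
  `AttractiveStiffnessCeilingU20Sharp`: `U = -20 t ⟹ ρ_s ≤ 0.4 < 4/π²` (landed crossing `|U| = 24.7 t`,
  now `|U| = 2π² t = 19.7 t`). With the density floor `ρ_s ≤ n` and Nelson–Kosterlitz this is the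
  model-class statement `T_c ≤ (π/2) min(n, 8 t²/|U|)` of bounds.tex Cor. 8.1♯ (conditional on NK there).

References (`lean/references.bib`): LangerMattis1971 eqs. (3)–(5); KennedyLieb1986 Thm 2.1;
KomaTasaki1994 §1; HazraVermaRanderia2019 §III, App. G; ScalapinoWhiteZhang1993 §II; LiebPRL1989.
-/

noncomputable section

namespace Summit.HubbardSuperconductivity.HubbardLadder.Bounds

open Matrix Finset Real Filter Topology
open Literature.MathematicalPhysics.QuantumLattice
open Literature.MathematicalPhysics.QuantumFieldTheory
open Literature.Probability.LatticeModels
open Literature.MathematicalPhysics.QuantumLattice.LangerMattis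
open Literature.MathematicalPhysics.QuantumLattice.ThermodynamicLimit
open Literature.MathematicalPhysics.QuantumLattice.HartreeFock
open scoped ComplexOrder ComplexConjugate Topology

variable {L : ℕ} [NeZero L]

/-! ### Half filling, `U = 8` and `U = 12`, with the tree's Langer–Mattis lower rows -/

/-- **Half filling, `U = 8`, tight hook from `U₁ = 4` (PROVED below)**: the kernel row
`e(4,1) ≥ -1.0897` and ANY certified `e(8,1) ≤ r` give `ρ_s ≤ (r + 2.1794)/4` for every stiffness
constant valid along all large even `L`. kind: support (PROVED). Why it might fail: it cannot. -/
@[conjecture] def StiffnessCeilingHalfFillingU8Sharp : Prop :=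
  ∀ (ρs θ₀ r : ℝ), 0 < ρs → 0 < θ₀ →
    (∃ L₀ : ℕ, ∀ (L : ℕ) [NeZero L], L₀ ≤ L → Even L →
      ∀ θ : ℝ, |θ| ≤ θ₀ → ρs * θ ^ 2 ≤ fluxEnergy L 8 0 θ - fluxEnergy L 8 0 0) →
    energyDensity2D 1 8 1 ≤ r → ρs ≤ (r + 2.1794) / 4

/-- **Proof of `StiffnessCeilingHalfFillingU8Sharp`.** -/
theorem stiffnessCeilingHalfFillingU8Sharp_holds : StiffnessCeilingHalfFillingU8Sharp := by
  intro ρs θ₀ r hρs hθ₀ hst hr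
  obtain ⟨L₀, hst⟩ := hst
  have h4 : (-1.0897 : ℝ) ≤ energyDensity2D 1 4 (1 - 0) := by
    rw [sub_zero]; exact energyDensity2D_one_four_one_ge
  have hr' : energyDensity2D 1 8 (1 - 0) ≤ r := by rw [sub_zero]; exact hr
  have h := stiffness_le_of_energyDensityBrackets_sharp (U := 8) (U₁ := 4) (δ := 0) (by norm_num)
    (by norm_num) (by norm_num) (by norm_num) hρs hθ₀ hst hr' h4
  have hring : ((4 : ℝ) * r - 8 * -1.0897) / (8 - 4) = r + 2.1794 := by ring
  linarith

/-- **Half filling, `U = 12`, tight hook from `U₁ = 6` (PROVED below)**: the kernel row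
`e(6,1) ≥ -0.88655` and ANY certified `e(12,1) ≤ r` give `ρ_s ≤ (r + 1.7731)/4`.
kind: support (PROVED). Why it might fail: it cannot. -/
@[conjecture] def StiffnessCeilingHalfFillingU12Sharp : Prop :=
  ∀ (ρs θ₀ r : ℝ), 0 < ρs → 0 < θ₀ →
    (∃ L₀ : ℕ, ∀ (L : ℕ) [NeZero L], L₀ ≤ L → Even L →
      ∀ θ : ℝ, |θ| ≤ θ₀ → ρs * θ ^ 2 ≤ fluxEnergy L 12 0 θ - fluxEnergy L 12 0 0) →
    energyDensity2D 1 12 1 ≤ r → ρs ≤ (r + 1.7731) / 4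

/-- **Proof of `StiffnessCeilingHalfFillingU12Sharp`.** -/
theorem stiffnessCeilingHalfFillingU12Sharp_holds : StiffnessCeilingHalfFillingU12Sharp := by
  intro ρs θ₀ r hρs hθ₀ hst hr
  obtain ⟨L₀, hst⟩ := hst
  have h6 : (-0.88655 : ℝ) ≤ energyDensity2D 1 6 (1 - 0) := by
    rw [sub_zero]; exact energyDensity2D_one_six_one_ge
  have hr' : energyDensity2D 1 12 (1 - 0) ≤ r := by rw [sub_zero]; exact hr
  have h := stiffness_le_of_energyDensityBrackets_sharp (U := 12) (U₁ := 6) (δ := 0) (by norm_num)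
    (by norm_num) (by norm_num) (by norm_num) hρs hθ₀ hst hr' h6
  have hring : ((6 : ℝ) * r - 12 * -0.88655) / (12 - 6) = r + 1.7731 := by ring
  linarith

/-- **`U = 12 t`, half filling: `ρ_s ≤ 0.3568 t < 4/π² = 0.40528`** for every stiffness constant
valid along all large even `L`, GIVEN the certified upper row `e(12,1) ≤ -0.3459422` (hypothesis; the
tree's typed row `energyDensityTT' 1 0 12 1 ≤ -2971620875/2^33` implies it). Lower input = kernel.
kind: support (PROVED below). Why it might fail: it cannot (the row is a hypothesis). -/
@[conjecture] def StiffnessCeilingHalfFillingU12Row : Prop :=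
  ∀ (ρs θ₀ : ℝ), 0 < ρs → 0 < θ₀ →
    (∃ L₀ : ℕ, ∀ (L : ℕ) [NeZero L], L₀ ≤ L → Even L →
      ∀ θ : ℝ, |θ| ≤ θ₀ → ρs * θ ^ 2 ≤ fluxEnergy L 12 0 θ - fluxEnergy L 12 0 0) →
    energyDensity2D 1 12 1 ≤ -0.3459422 → ρs ≤ 0.3568

/-- **Proof of `StiffnessCeilingHalfFillingU12Row`.** -/
theorem stiffnessCeilingHalfFillingU12Row_holds : StiffnessCeilingHalfFillingU12Row := by
  intro ρs θ₀ hρs hθ₀ hst hr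
  have h := stiffnessCeilingHalfFillingU12Sharp_holds ρs θ₀ (-0.3459422) hρs hθ₀ hst hr
  norm_num at h
  linarith

/-! ### The Mott window (bounds.tex Thm 7(v♯)(vi♯)) -/

/-- **Thm 7(v♯) (tight Mott stiffness ceiling, finite even torus; PROVED below).** `L ≥ 3` even,
`0 ≤ U₁ < U`, `Δ ≠ 0`, `ρ_s > 0` a flux stiffness of the half-filled `(L², S^z = 0)` sector of
`hubbardTorus 2 L 1 U`. Then `ρ_s ≤ ((U₁ sdwClosed U Δ - U lmClosed U₁)/(U - U₁))/4`.
kind: support (PROVED). Why it might fail: it cannot; above `4/π²` for `U ≲ 13.5 t`.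
Sources: LangerMattis1971 eqs. (3)–(5); KomaTasaki1994 §1; this cell. -/
@[conjecture] def MottStiffnessCeilingSharp : Prop :=
  ∀ (L : ℕ) [NeZero L], 3 ≤ L → Even L → ∀ (U U₁ Δ ρs θ₀ : ℝ), 0 ≤ U₁ → U₁ < U → Δ ≠ 0 → 0 < ρs →
    0 < θ₀ → (∀ θ : ℝ, |θ| ≤ θ₀ → ρs * θ ^ 2 ≤ fluxEnergy L U 0 θ - fluxEnergy L U 0 0) →
      ρs ≤ ((U₁ * sdwClosed U Δ - U * lmClosed U₁) / (U - U₁)) / 4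

/-- **Proof of `MottStiffnessCeilingSharp`**: the tight node at `δ = 0` with `R = L² sdwClosed U Δ`,
`L₁ = L² lmClosed U₁`. -/
theorem mottStiffnessCeilingSharp_holds : MottStiffnessCeilingSharp := by
  intro L _ hL hLe U U₁ Δ ρs θ₀ hU₁ hU hΔ hρs hθ₀ hst
  have hU0 : 0 ≤ U := hU₁.trans hU.le
  have hL2 : (0 : ℝ) < (L : ℝ) ^ 2 := by have := NeZero.pos L; positivity
  have hE : ∀ U' : ℝ, fluxEnergy L U' 0 0 = groundEnergyAt (fermionTorusGraph 2 L) 1 U' (L ^ 2) := by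
    intro U'
    rw [fluxEnergy_zero_eq_groundEnergyAt U' 0 (by norm_num), sub_zero, rectN_one_of_even hLe]
  have hR : fluxEnergy L U 0 0 ≤ (L : ℝ) ^ 2 * sdwClosed U Δ := by
    rw [hE]; exact hubbardTorus_groundEnergyAt_le_sdwClosed hLe hL hU0 hΔ
  have hL₁ : (L : ℝ) ^ 2 * lmClosed U₁ ≤ fluxEnergy L U₁ 0 0 := by
    rw [hE]; exact hubbardTorus_groundEnergyAt_sq_ge_lmClosed hLe hL U₁
  have h := stiffnessCeilingFromEnergyBracketsSharp_holds L hL U U₁ 0 ρs θ₀ (by norm_num) hU₁ hU hρs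
    hθ₀ hst _ _ hR hL₁
  have key : (U₁ * ((L : ℝ) ^ 2 * sdwClosed U Δ) - U * ((L : ℝ) ^ 2 * lmClosed U₁)) / (U - U₁) / 4 =
      ((U₁ * sdwClosed U Δ - U * lmClosed U₁) / (U - U₁) / 4) * (L : ℝ) ^ 2 := by
    ring
  rw [key] at h
  exact le_of_mul_le_mul_right h hL2

/-- **Thm 7(vi♯) (tight Mott stiffness ceiling, thermodynamic limit; PROVED below).**
kind: support (PROVED). Why it might fail: it cannot. Sources: as Thm 7(v♯). -/
@[conjecture] def MottStiffnessCeilingSharpTL : Prop :=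
  ∀ (U U₁ Δ ρs θ₀ : ℝ), 0 ≤ U₁ → U₁ < U → Δ ≠ 0 → 0 < ρs → 0 < θ₀ →
    (∃ L₀ : ℕ, ∀ (L : ℕ) [NeZero L], L₀ ≤ L → Even L →
      ∀ θ : ℝ, |θ| ≤ θ₀ → ρs * θ ^ 2 ≤ fluxEnergy L U 0 θ - fluxEnergy L U 0 0) →
    ρs ≤ ((U₁ * sdwClosed U Δ - U * lmClosed U₁) / (U - U₁)) / 4

/-- **Proof of `MottStiffnessCeilingSharpTL`.** -/
theorem mottStiffnessCeilingSharpTL_holds : MottStiffnessCeilingSharpTL := by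
  intro U U₁ Δ ρs θ₀ hU₁ hU hΔ hρs hθ₀ hst
  have hU0 : 0 ≤ U := hU₁.trans hU.le
  have h := stiffnessCeilingFromEnergyDensityBracketsSharp_holds U U₁ 0 ρs θ₀ hU₁ hU (by norm_num)
    (by norm_num) hρs hθ₀ hst (sdwClosed U Δ) (lmClosed U₁)
  simp only [sub_zero] at h
  exact h (energyDensity2D_one_le_sdwClosed hU0 hΔ) (energyDensity2D_one_ge_lmClosed hU₁)

/-- A lower decimal bound on `4/√x` from an upper decimal bound on `√x`. -/
theorem four_div_sqrt_ge' {x q c : ℝ} (hx : 0 < x) (hq : Real.sqrt x ≤ q) (hc : 0 ≤ c)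
    (hcq : c * q ≤ 4) : c ≤ 4 / Real.sqrt x := by
  rw [le_div_iff₀ (Real.sqrt_pos.2 hx)]; nlinarith

/-- Decimal arithmetic for `U = 14`, `U₁ = Δ = 7`: `A = 4/√65 ≥ 0.49613`, `B = √7.0625 ≤ 2.6576`. -/
theorem mott_sharp_numeric_14 {A B : ℝ} (hA : 0.49613 ≤ A) (hB : B ≤ 2.6576) :
    (7 * (-A + 14 / (4 + 7 ^ 2)) - 14 * (7 / 4 - B)) / (14 - 7) / 4 ≤ (0.4 : ℝ) := by
  norm_num at hA hB ⊢
  linarith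

/-- Decimal arithmetic for `U = 20`, `U₁ = Δ = 10`: `A = 4/√116 ≥ 0.37138`, `B = √10.25 ≤ 3.2016`. -/
theorem mott_sharp_numeric_20 {A B : ℝ} (hA : 0.37138 ≤ A) (hB : B ≤ 3.2016) :
    (10 * (-A + 20 / (4 + 10 ^ 2)) - 20 * (10 / 4 - B)) / (20 - 10) / 4 ≤ (0.307 : ℝ) := by
  norm_num at hA hB ⊢
  linarith

/-- **`U = 14 t`: `ρ_s ≤ 0.4 t`** (`< 4/π² = 0.4053`) for every flux stiffness of the half-filled
sector of every even torus `L ≥ 4` (`U₁ = Δ = 7`; exact value of the closed form `0.39577`; the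
landed three-bracket form gives `0.477` here). kind: support (PROVED). -/
@[conjecture] def MottStiffnessCeilingU14Sharp : Prop :=
  ∀ (L : ℕ) [NeZero L], 3 ≤ L → Even L → ∀ (ρs θ₀ : ℝ), 0 < ρs → 0 < θ₀ →
    (∀ θ : ℝ, |θ| ≤ θ₀ → ρs * θ ^ 2 ≤ fluxEnergy L 14 0 θ - fluxEnergy L 14 0 0) → ρs ≤ 0.4

/-- **Proof of `MottStiffnessCeilingU14Sharp`.** -/
theorem mottStiffnessCeilingU14Sharp_holds : MottStiffnessCeilingU14Sharp := by
  intro L _ hL hLe ρs θ₀ hρs hθ₀ hst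
  have h := mottStiffnessCeilingSharp_holds L hL hLe 14 7 7 ρs θ₀ (by norm_num) (by norm_num)
    (by norm_num) hρs hθ₀ hst
  have hA : (0.49613 : ℝ) ≤ 4 / Real.sqrt (16 + 7 ^ 2) :=
    four_div_sqrt_ge' (by norm_num) (Real.sqrt_le_iff.2 ⟨by norm_num, by norm_num⟩ :
      Real.sqrt (16 + 7 ^ 2) ≤ 8.06226) (by norm_num) (by norm_num)
  have hB : Real.sqrt (4 + (7 / 4) ^ 2) ≤ 2.6576 := Real.sqrt_le_iff.2 ⟨by norm_num, by norm_num⟩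
  simp only [sdwClosed, lmClosed] at h
  exact h.trans (mott_sharp_numeric_14 hA hB)

/-- **`U = 20 t`: `ρ_s ≤ 0.307 t`** (landed: `0.36`) for every flux stiffness of the half-filled
sector of every even torus `L ≥ 4` (`U₁ = Δ = 10`; exact value `0.30601`). kind: support (PROVED). -/
@[conjecture] def MottStiffnessCeilingU20Sharp : Prop :=
  ∀ (L : ℕ) [NeZero L], 3 ≤ L → Even L → ∀ (ρs θ₀ : ℝ), 0 < ρs → 0 < θ₀ →
    (∀ θ : ℝ, |θ| ≤ θ₀ → ρs * θ ^ 2 ≤ fluxEnergy L 20 0 θ - fluxEnergy L 20 0 0) → ρs ≤ 0.307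

/-- **Proof of `MottStiffnessCeilingU20Sharp`.** -/
theorem mottStiffnessCeilingU20Sharp_holds : MottStiffnessCeilingU20Sharp := by
  intro L _ hL hLe ρs θ₀ hρs hθ₀ hst
  have h := mottStiffnessCeilingSharp_holds L hL hLe 20 10 10 ρs θ₀ (by norm_num) (by norm_num)
    (by norm_num) hρs hθ₀ hst
  have hA : (0.37138 : ℝ) ≤ 4 / Real.sqrt (16 + 10 ^ 2) :=
    four_div_sqrt_ge' (by norm_num) (Real.sqrt_le_iff.2 ⟨by norm_num, by norm_num⟩ :
      Real.sqrt (16 + 10 ^ 2) ≤ 10.7704) (by norm_num) (by norm_num)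
  have hB : Real.sqrt (4 + (10 / 4) ^ 2) ≤ 3.2016 := Real.sqrt_le_iff.2 ⟨by norm_num, by norm_num⟩
  simp only [sdwClosed, lmClosed] at h
  exact h.trans (mott_sharp_numeric_20 hA hB)

/-! ### The attractive class (bounds.tex Thm 8♯) -/

/-- The tight attractive chord with the closed-form brackets `E(U) ≤ U m`,
`E(U/2) ≥ (U/2) m - 8 L²/(|U|/2)`: `⟨-T⟩_ψ ≤ 32 L²/|U|` (landed: `40 L²/|U|`). -/
theorem two_mul_kinWeight_le_attractive_sharp (hLe : Even L) (hL : 3 ≤ L) {U : ℝ} (hU : U < 0)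
    {m : ℕ} (hm : m ≤ L ^ 2) {ψ : Fock (Orb (FermionTorus 2 L))}
    (hgs : IsGroundStateInSector (hubbardTorus 2 L 1 U) (2 * m) 0 ψ) (h1 : star ψ ⬝ᵥ ψ = 1) :
    2 * (kinWeightDir 0 ψ + kinWeightDir 1 ψ) ≤ 32 * (L : ℝ) ^ 2 / (-U) := by
  have hR := sectorEnergy_two_mul_le_mul (L := L) U hm
  have hL₁ := sectorEnergy_two_mul_ge_attractive hLe hL (U := U / 2) (by linarith) hm
  have h := two_mul_kinWeight_le_of_energyBrackets_attractive_sharp hL (U₁ := U / 2) (by linarith)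
    (by linarith) hgs h1 hR hL₁
  have hU0 : U ≠ 0 := hU.ne
  have hV : -U ≠ 0 := neg_ne_zero.2 hU0
  have hV2 : -(U / 2) ≠ 0 := by
    intro h'
    apply hU0
    linarith
  have hd : U / 2 - U ≠ 0 := by
    intro h'
    apply hU0
    linarith
  have key : (U * (U / 2 * m - 8 * (L : ℝ) ^ 2 / (-(U / 2))) - U / 2 * (U * m)) / (U / 2 - U) =
      32 * (L : ℝ) ^ 2 / (-U) := by
    field_simp
    ring
  linarith

/-- **Thm 8♯(i) (tight attractive kinetic-energy ceiling; PROVED below).** `L ≥ 3` even, `U < 0`,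
`m ≤ L²`: every unit ground state `ψ` of `hubbardTorus 2 L 1 U` in the sector `(2m, S^z = 0)` has
`⟨-T⟩_ψ ≤ 32 L²/|U|`. kind: support (PROVED). Why it might fail: it cannot; informative for
`|U| ≳ 8 t/n` only. Sources: LangerMattis1971; KennedyLieb1986 Thm 2.1; KomaTasaki1994 §1. -/
@[conjecture] def AttractiveKineticCeilingSharp : Prop :=
  ∀ (L : ℕ) [NeZero L], 3 ≤ L → Even L → ∀ (U : ℝ) (m : ℕ), U < 0 → m ≤ L ^ 2 →
    ∀ ψ : Fock (Orb (FermionTorus 2 L)), IsGroundStateInSector (hubbardTorus 2 L 1 U) (2 * m) 0 ψ →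
      star ψ ⬝ᵥ ψ = 1 → 2 * (kinWeightDir 0 ψ + kinWeightDir 1 ψ) ≤ 32 * (L : ℝ) ^ 2 / (-U)

/-- **Proof of `AttractiveKineticCeilingSharp`.** -/
theorem attractiveKineticCeilingSharp_holds : AttractiveKineticCeilingSharp := by
  intro L _ hL hLe U m hU hm ψ hgs h1
  exact two_mul_kinWeight_le_attractive_sharp hLe hL hU hm hgs h1

/-- **Thm 8♯(ii) (tight attractive stiffness ceiling, finite even torus; PROVED below).** `L ≥ 3`
even, `U < 0`, any filling `δ ≥ -1`: every flux stiffness `ρ_s > 0` of the `(N_L, S^z = 0)` sector of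
`hubbardTorus 2 L 1 U` satisfies `ρ_s ≤ 8/|U|` (`t = 1`; landed: `10/|U|`), uniformly in `L`, `δ`.
kind: support (PROVED). Why it might fail: it cannot; below `4/π²` only for `|U| > 2π² t = 19.74 t`
and blind to the density. Sources: as Thm 8♯(i); ScalapinoWhiteZhang1993 §II. -/
@[conjecture] def AttractiveStiffnessCeilingSharp : Prop :=
  ∀ (L : ℕ) [NeZero L], 3 ≤ L → Even L → ∀ (U δ ρs θ₀ : ℝ), -1 ≤ δ → U < 0 → 0 < ρs → 0 < θ₀ →
    (∀ θ : ℝ, |θ| ≤ θ₀ → ρs * θ ^ 2 ≤ fluxEnergy L U δ θ - fluxEnergy L U δ 0) → ρs ≤ 8 / (-U)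

/-- **Proof of `AttractiveStiffnessCeilingSharp`**: the landed attractive node with `Em = R = E_L(U;0)`
exact and the closed-form `L₁` at `U₁ = U/2` (= the tight chord at the exact energy), then
`E_L(U;0) ≤ U m`. -/
theorem attractiveStiffnessCeilingSharp_holds : AttractiveStiffnessCeilingSharp := by
  intro L _ hL hLe U δ ρs θ₀ hδ hU hρs hθ₀ hst
  have hm : ⌊(1 - δ) * (L : ℝ) ^ 2 / 2⌋₊ ≤ L ^ 2 := NoGo.floor_pairNumber_le δ hδ L
  set m : ℕ := ⌊(1 - δ) * (L : ℝ) ^ 2 / 2⌋₊ with hm_def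
  have hR : fluxEnergy L U δ 0 ≤ U * m := by
    rw [fluxEnergy_zero_eq_sectorEnergy]; exact sectorEnergy_two_mul_le_mul (L := L) U hm
  have hL₁ : U / 2 * m - 8 * (L : ℝ) ^ 2 / (-(U / 2)) ≤ fluxEnergy L (U / 2) δ 0 := by
    rw [fluxEnergy_zero_eq_sectorEnergy]
    exact sectorEnergy_two_mul_ge_attractive hLe hL (U := U / 2) (by linarith) hm
  have h := stiffnessCeilingFromEnergyBracketsAttractive_holds L hL U (U / 2) δ ρs θ₀ hδ hU.le
    (by linarith) hρs hθ₀ hst _ _ _ le_rfl le_rfl hL₁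
  have hU0 : U ≠ 0 := hU.ne
  have hV : -U ≠ 0 := neg_ne_zero.2 hU0
  have hV2 : -(U / 2) ≠ 0 := by
    intro h'
    apply hU0
    linarith
  have hd : U / 2 - U ≠ 0 := by
    intro h'
    apply hU0
    linarith
  have key : (-U * ((fluxEnergy L U δ 0 - (U / 2 * m - 8 * (L : ℝ) ^ 2 / (-(U / 2)))) / (U / 2 - U)) -
      fluxEnergy L U δ 0) / 4 = (fluxEnergy L U δ 0 - U * m) / 4 + 8 / (-U) * (L : ℝ) ^ 2 := by
    field_simp
    ring
  rw [key] at h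
  have hL2 : (0 : ℝ) < (L : ℝ) ^ 2 := by have := NeZero.pos L; positivity
  exact le_of_mul_le_mul_right (by linarith) hL2

/-- **Tight BEC limit (PROVED below)**: `L ≥ 3` even, `δ ≥ -1`, `ε > 0`, `U ≤ -8/ε`: every flux
stiffness `ρ_s > 0` of the `(N_L, S^z = 0)` sector satisfies `ρ_s ≤ ε`. kind: support (PROVED). -/
@[conjecture] def AttractiveStiffnessBECLimitSharp : Prop :=
  ∀ (L : ℕ) [NeZero L], 3 ≤ L → Even L → ∀ (U δ ρs θ₀ ε : ℝ), -1 ≤ δ → 0 < ε → U ≤ -(8 / ε) →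
    0 < ρs → 0 < θ₀ →
    (∀ θ : ℝ, |θ| ≤ θ₀ → ρs * θ ^ 2 ≤ fluxEnergy L U δ θ - fluxEnergy L U δ 0) → ρs ≤ ε

/-- **Proof of `AttractiveStiffnessBECLimitSharp`**: `8/|U| ≤ ε`. -/
theorem attractiveStiffnessBECLimitSharp_holds : AttractiveStiffnessBECLimitSharp := by
  intro L _ hL hLe U δ ρs θ₀ ε hδ hε hUε hρs hθ₀ hst
  have h8 : 0 < 8 / ε := by positivity
  have hU : U < 0 := by linarith
  have h := attractiveStiffnessCeilingSharp_holds L hL hLe U δ ρs θ₀ hδ hU hρs hθ₀ hst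
  have hV : 0 < -U := neg_pos.2 hU
  have hle : 8 / (-U) ≤ ε := by
    rw [div_le_iff₀ hV]
    have h' : 8 / ε ≤ -U := by linarith
    have h'' := (div_le_iff₀ hε).1 h'
    linarith
  exact h.trans hle

/-- **Thm 8♯(iii) (tight attractive ceiling, thermodynamic limit; PROVED below)**: a stiffness constant
of the `(N_L, S^z = 0)` sectors of `hubbardTorus 2 L 1 U` (`U < 0`, `δ ≥ -1`) valid along all large
even `L` obeys `ρ_s ≤ 8/|U|`. kind: support (PROVED). Why it might fail: it cannot. -/
@[conjecture] def AttractiveStiffnessCeilingSharpTL : Prop :=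
  ∀ (U δ ρs θ₀ : ℝ), -1 ≤ δ → U < 0 → 0 < ρs → 0 < θ₀ →
    (∃ L₀ : ℕ, ∀ (L : ℕ) [NeZero L], L₀ ≤ L → Even L →
      ∀ θ : ℝ, |θ| ≤ θ₀ → ρs * θ ^ 2 ≤ fluxEnergy L U δ θ - fluxEnergy L U δ 0) → ρs ≤ 8 / (-U)

/-- **Proof of `AttractiveStiffnessCeilingSharpTL`** (the finite ceiling is uniform in `L`). -/
theorem attractiveStiffnessCeilingSharpTL_holds : AttractiveStiffnessCeilingSharpTL := by
  intro U δ ρs θ₀ hδ hU hρs hθ₀ hst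
  obtain ⟨L₀, hst⟩ := hst
  haveI : NeZero (2 * (L₀ + 2)) := ⟨by omega⟩
  exact attractiveStiffnessCeilingSharp_holds (2 * (L₀ + 2)) (by omega) (even_two_mul _) U δ ρs θ₀ hδ
    hU hρs hθ₀ (hst (2 * (L₀ + 2)) (by omega) (even_two_mul _))

/-- **`U = -20 t`: `ρ_s ≤ 0.4 t < 4/π² = 0.4053`** for every flux stiffness of the `(N_L, S^z = 0)`
sector of every even torus `L ≥ 4`, every filling (landed: `ρ_s ≤ 0.25` needed `U = -40 t`).
kind: support (PROVED). -/
@[conjecture] def AttractiveStiffnessCeilingU20Sharp : Prop :=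
  ∀ (L : ℕ) [NeZero L], 3 ≤ L → Even L → ∀ (δ ρs θ₀ : ℝ), -1 ≤ δ → 0 < ρs → 0 < θ₀ →
    (∀ θ : ℝ, |θ| ≤ θ₀ → ρs * θ ^ 2 ≤ fluxEnergy L (-20) δ θ - fluxEnergy L (-20) δ 0) → ρs ≤ 0.4

/-- **Proof of `AttractiveStiffnessCeilingU20Sharp`.** -/
theorem attractiveStiffnessCeilingU20Sharp_holds : AttractiveStiffnessCeilingU20Sharp := by
  intro L _ hL hLe δ ρs θ₀ hδ hρs hθ₀ hst
  have h := attractiveStiffnessCeilingSharp_holds L hL hLe (-20) δ ρs θ₀ hδ (by norm_num) hρs hθ₀ hst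
  norm_num at h
  linarith

end Summit.HubbardSuperconductivity.HubbardLadder.Bounds

end
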